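import Mathlib
import Summits.Ventures.PercRepro2.ExplorationTreeCov
import Summits.Ventures.PercRepro2.ExplorationCanonical

/-!
# The cell's own explorations as stopping explorations (blind cell PercRepro2, typer-1 g19; a
language line)

The T-explorations of `ExplorationT.lean` (p1 g5's SL1 machinery: a valid tree with T-leaves and
seed sets) and the canonical exploration from `a₃` of `ExplorationCanonical.lean` are stopping
explorations in the sense of `ExplorationTreeCondExp.lean`; the per-leaf quantities of the SL1
sub-lemma are values of the pinned mean `leafMean` on the leaves:

* `condExp_leafSigma_TExploration` / `condExp_leafSigma_canonical`: the conditional expectation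
  given a T-exploration (the canonical one) is the pinned expectation at its leaf;
* `covariance_eq_sum_leaves_TExploration`: the law of total covariance over a T-exploration;
* `leafQ_eq_leafMean` / `leafA_eq_leafMean` / `leafB_eq_leafMean`: p1's `leafQ ℓ = P(Q ∣ ℓ)`,
  `leafA ℓ`, `leafB ℓ` are the values of `leafMean` on `ℓ.event`.

Identities only; nothing about the sign of any term.
-/

namespace Summit.Ventures.PercRepro2

open MeasureTheory ProbabilityTheory MeasureBridge

namespace ExplorationTree

section Instances

variable {V : Type*} {E : Type*} [Fintype E] [DecidableEq E] {ends : E → Sym2 V} {a₁ a₂ a₃ : V}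

/-- **A T-exploration is a stopping exploration**: the conditional expectation given it is the
pinned expectation at its leaf. -/
theorem condExp_leafSigma_TExploration (p : E → ℝ) (hp : IsProbVec p)
    (τ : TExploration ends a₁ a₂ a₃) (f : Config E → ℝ) :
    (percMeasureOf p hp)[f | leafSigma τ.tree] =ᵐ[percMeasureOf p hp] leafMean p τ.tree f :=
  condExp_leafSigma p hp τ.tree τ.valid f

/-- The law of total covariance over a T-exploration. -/
theorem covariance_eq_sum_leaves_TExploration (p : E → ℝ) (hp : IsProbVec p)
    (τ : TExploration ends a₁ a₂ a₃) (f g : Config E → ℝ) :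
    cov[f, g; percMeasureOf p hp] =
      ((leaves τ.tree root).map fun ℓ => prob p ℓ.event *
        (cov[f, g; percMeasureOf (pin p ℓ) (isProbVec_pin hp ℓ)] +
          (expect (pin p ℓ) f - expect p f) * (expect (pin p ℓ) g - expect p g))).sum :=
  covariance_eq_sum_leaves p hp τ.tree τ.valid f g

/-- p1's `leafQ ℓ = P(Q ∣ ℓ)` is the value of the pinned mean of `1_Q` on `ℓ.event`. -/
theorem leafQ_eq_leafMean (p : E → ℝ) (τ : TExploration ends a₁ a₂ a₃) {ℓ : Partial E}
    (hℓ : ℓ ∈ leaves τ.tree root) {ω : Config E} (hω : ω ∈ ℓ.event) :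
    leafQ p ends a₁ a₂ ℓ = leafMean p τ.tree ((avoidAll ends a₂ {a₁}).indicator 1) ω := by
  unfold leafQ leafMean
  rw [leafOf_eq_of_mem_event τ.tree root τ.valid ℓ hℓ ω hω, prob_eq_expect_indicator]

/-- p1's per-path share slack `leafA ℓ` is the value of a pinned mean on `ℓ.event`. -/
theorem leafA_eq_leafMean (p : E → ℝ) (τ : TExploration ends a₁ a₂ a₃) (o : V) {ℓ : Partial E}
    (hℓ : ℓ ∈ leaves τ.tree root) {ω : Config E} (hω : ω ∈ ℓ.event) :
    leafA p ends o a₁ a₂ a₃ ℓ =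
      leafMean p τ.tree (fun ω' =>
        ((prob p (PDEvent ends a₁ a₂ a₃ ∩ connEvent ends a₁ o) +
            prob p (PDEvent ends a₁ a₂ a₃ ∩ connEvent ends a₂ o)) -
          prob p (PDEvent ends a₁ a₂ a₃) *
            delClusterProb p ends a₁ {W | o ∈ W} (cluster ends ω' a₂)) *
        (avoidAll ends a₂ {a₁}).indicator 1 ω') ω := by
  unfold leafA leafMean
  rw [leafOf_eq_of_mem_event τ.tree root τ.valid ℓ hℓ ω hω]

/-- p1's per-path margin `leafB ℓ` is the value of a pinned mean on `ℓ.event`. -/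
theorem leafB_eq_leafMean (p : E → ℝ) (τ : TExploration ends a₁ a₂ a₃) (b : V) {ℓ : Partial E}
    (hℓ : ℓ ∈ leaves τ.tree root) {ω : Config E} (hω : ω ∈ ℓ.event) :
    leafB p ends a₁ a₂ b ℓ =
      leafMean p τ.tree (fun ω' =>
        (Yu1.ind b (cluster ends ω' a₂) - delClusterProb p ends a₁ {W | b ∈ W} (cluster ends ω' a₂)) *
        (avoidAll ends a₂ {a₁}).indicator 1 ω') ω := by
  unfold leafB leafMean
  rw [leafOf_eq_of_mem_event τ.tree root τ.valid ℓ hℓ ω hω]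

variable [Fintype V] [DecidableEq V]

/-- **The canonical exploration from `a₃` is a stopping exploration**. -/
theorem condExp_leafSigma_canonical (p : E → ℝ) (hp : IsProbVec p) (ends : E → Sym2 V)
    (a₁ a₂ a₃ : V) (es : List E) (hes : ∀ e, e ∈ es) (f : Config E → ℝ) :
    (percMeasureOf p hp)[f | leafSigma (Canonical.canonical ends a₁ a₂ a₃ es hes).tree]
      =ᵐ[percMeasureOf p hp] leafMean p (Canonical.canonical ends a₁ a₂ a₃ es hes).tree f :=
  condExp_leafSigma_TExploration p hp _ f

end Instances

end ExplorationTree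

end Summit.Ventures.PercRepro2
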